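/-
Copyright: cell `langlands-arthur-audit` (papers/Langlands/langlands-arthur-audit), unit `pub-arthur-carver-g4`
(CARVER gen 4, 2026-08-18).  Staged for the tree under `Literature/NumberTheory/Automorphic/Arthur2013/Leaves/`
(LEAN-IN-TREE rule 2026-08-18); imports the three DAG modules (M1, M10, M11) and `Leaves.GlobalTheorems` (M20).
Module map: M23; global companion of `Leaves/BridgeFull.lean` (M22).
-/
import Literature.NumberTheory.Automorphic.Arthur2013.DependencyDag
import Literature.NumberTheory.Automorphic.Mok2015.DependencyDag
import Literature.NumberTheory.Automorphic.KMSW2014.DependencyDag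
import Literature.NumberTheory.Automorphic.Arthur2013.Leaves.GlobalTheorems

/-!
# Arthur (2013) audit, typed leaves — §9c FULL-CONTENT READINGS of the GLOBAL DAG nodes T152, T412, [Mok] T252, T512, [KMSW] T171, T171p

Global companion of `Leaves/BridgeFull.lean` (M22), answering the referee note GAPS G-REF-g7-3 (e): the
content-carrying statements `Book.T152`, `Book.T412`, `Mok.T252`, `Mok.T512`, `KMSW.T171` of
`Leaves/GlobalTheorems.lean` (M20) — the printed global theorems typed at each irreducible `π` — "are NOT yet
bridged to the opaque DAG nodes `Nodes.T152` / `T412`".  As in M22, this module states as HYPOTHESES a reader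
may adopt that the DAG nodes (indexed by the rank of the induction; the printed statement is the conjunction
over all ranks) ARE those typed printed theorems, and proves:

* `Book.T152_of_leaves`, `Book.T412_of_leaves` ([Ar] Thms 1.5.2, 4.1.2), `Mok.T252_of_leaves`,
  `Mok.T512_of_leaves` ([Mok] Thms 2.5.2, 5.1.2), `KMSW.T501p_of_leaves` ([KMSW] Thm 5.0.1 on its proved
  region), `KMSW.T171_of_leaves` ([KMSW] Thm* 1.7.1 as stated, needing the unwritten sequels) — under the full
  reading, the printed theorem follows from EXACTLY the leaf bundles of the respective kernel DAG (M1
  `Nodes.main_of_leaves` / `T152_of_leaves`, M10 `Mok2015.Nodes.main_of_leaves` / `T252_of_leaves`, M11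
  `KMSW2014.Nodes.T171p_of_leaves` / `full_of_leaves`): no new leaf;
* `…fullNodesGlobal_reads` — the readings are CONSISTENT;
* `KMSW.proved_reading_not_stated` — the proved-region reading of T171p does not give the componentwise formula
  on the STATED region (transport of M20 `KMSW.global_separates`: the two cells deferred to [KMS_A], [KMS_B]).

Nothing here asserts that any node is true or touches a landed statement.  The Book `Arthur2013` is NOT held by
the cell (acq-04129): "[Ar, Thm 1.5.2 / 4.1.2]" are the survey's `Arthur2013Survey` pp.7, 16 restatements,
second-hand, exactly as in M20.  No `axiom`, `sorry`, `opaque`; no Mathlib.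
-/

set_option autoImplicit false

namespace Literature.NumberTheory.Automorphic.Arthur2013.Leaves

section GlobalFullReads

/-- **Full reading of the [Ar] global nodes T152 and T412.**  Hypotheses: the DAG nodes `Arthur2013.Nodes.T152`
/ `T412` (at every rank) are the printed Thm 1.5.2 (multiplicity formula with the `m_ψ` rule, [TIFR] Theorem 2
= [A, Theorem 1.5.2], `[paper:url-560716e7679e p.7]`) / Thm 4.1.2 (stable multiplicity formula, [TIFR] Theorem
2′(a) = [A, Theorem 4.1.2], p.16) as typed in M20: `Book.T152 Γ` / `Book.T412 Γ`.
[cite: Arthur2013, Thms 1.5.2 and 4.1.2 (restated in Arthur2013Survey pp.7, 16; reading hypothesis, GAPS G-REF-g7-3 (e))] -/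
structure Book.ReadsFullGlobal (ν : Nodes) (Γ : GlobalWorld) : Prop where
  /-- T152 at every rank ↔ Thm 1.5.2 as printed on `Book.globalScope` -/
  t152 : (∀ N, ν.T152 N) ↔ Book.T152 Γ
  /-- T412 at every rank ↔ Thm 4.1.2(a) as printed on `Book.globalScope` -/
  t412 : (∀ N, ν.T412 N) ↔ Book.T412 Γ

/-- **Full reading of the [Mok] global nodes T252 and T512.**  Hypotheses: `Mok2015.Nodes.T252` / `T512` at
every rank are [Mok] Thm 2.5.2 (`main.tex:L1338–L1343`) / Thm 5.1.2 (`L4003–L4012`) as typed in M20: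
`Mok.T252 Γ` / `Mok.T512 Γ` (each with `m_ψ = 1`, `MultiplicityOne`).
[cite: Mok2012, Thms 2.5.2 and 5.1.2 (l.1338-1343, l.4003-4012; reading hypothesis)] -/
structure Mok.ReadsFullGlobal (μ : Mok2015.Nodes) (Γ : GlobalWorld) : Prop where
  /-- T252 at every rank ↔ Thm 2.5.2 as printed on `Mok.globalScope` -/
  t252 : (∀ N, μ.T252 N) ↔ Mok.T252 Γ
  /-- T512 at every rank ↔ Thm 5.1.2 as printed on `Mok.globalScope` -/
  t512 : (∀ N, μ.T512 N) ↔ Mok.T512 Γ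

/-- **Full readings of the [KMSW] global nodes T171 (as stated) and T171p (as proved).**  Hypotheses:
`KMSW2014.Nodes.T171` at every rank is Thm* 1.7.1 as printed (`chap1mainthms.tex:L348–L351`), `KMSW.T171 Γ` of
M20; `KMSW2014.Nodes.T171p` at every rank is the componentwise formula Thm 5.0.1 (`chap6.tex:L17–L22`) on the
region where arXiv:1409.3731 proves it, M20's `MultiplicityFormula Γ KMSW.globalProvedAt` (`chap6.tex:L15`
"These have been established if $\psi=\phi$ is generic and if $(G,\xi)$ is realized as a pure inner twist of
$G^*$.", quoted in M20).
[cite: KalethaEtAl2014, Thm* 1.7.1 (l.348-351) and Thm 5.0.1 (chap6 l.11-22; reading hypothesis)] -/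
structure KMSW.ReadsFullGlobal (κ : KMSW2014.Nodes) (Γ : GlobalWorld) : Prop where
  /-- T171 at every rank ↔ Thm* 1.7.1 as printed on `KMSW.globalScope` -/
  t171 : (∀ N, κ.T171 N) ↔ KMSW.T171 Γ
  /-- T171p at every rank ↔ Thm 5.0.1 on `KMSW.globalProvedAt` -/
  t171p : (∀ N, κ.T171p N) ↔ MultiplicityFormula Γ KMSW.globalProvedAt

/-- **[Ar, Thm 1.5.2] AS PRINTED from the leaves.**  Under the full reading, the printed multiplicity formula
with the `m_ψ` rule follows from the book-internal edges, the supply edges and EXACTLY the three leaf bundles of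
the kernel DAG (M1 `Nodes.T152_of_leaves`); 2026 status = that of the leaf set, no new leaf.
[cite: Arthur2013, Thm 1.5.2 (bookkeeping proved here; via Arthur2013Survey p.7)] -/
theorem Book.T152_of_leaves {ν : Nodes} {Γ : GlobalWorld} (h : Book.ReadsFullGlobal ν Γ) (B : ν.BookEdges)
    (S : ν.SupplyEdges) (P : ν.PublishedLeaves) (Q : ν.PreprintLeaves2026) (U : ν.UnwrittenLeaves) :
    Book.T152 Γ :=
  h.t152.mp (ν.T152_of_leaves B S P Q U)

/-- **[Ar, Thm 4.1.2(a)] AS PRINTED from the leaves** (projection of M1 `Nodes.main_of_leaves`: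
`GlobalAll N = T141 ∧ T142 ∧ T152 ∧ T153 ∧ T412 ∧ T422`), under the full reading.
[cite: Arthur2013, Thm 4.1.2 (bookkeeping proved here; via Arthur2013Survey p.16)] -/
theorem Book.T412_of_leaves {ν : Nodes} {Γ : GlobalWorld} (h : Book.ReadsFullGlobal ν Γ) (B : ν.BookEdges)
    (S : ν.SupplyEdges) (P : ν.PublishedLeaves) (Q : ν.PreprintLeaves2026) (U : ν.UnwrittenLeaves) :
    Book.T412 Γ :=
  h.t412.mp fun N => (ν.main_of_leaves B S P Q U N).2.2.2.2.2.1

/-- **[Mok, Thm 2.5.2] AS PRINTED from the leaves** of the Mok DAG (M10 `Mok2015.Nodes.T252_of_leaves`), under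
the full reading. [cite: Mok2012, Thm 2.5.2 (bookkeeping proved here)] -/
theorem Mok.T252_of_leaves {μ : Mok2015.Nodes} {Γ : GlobalWorld} (h : Mok.ReadsFullGlobal μ Γ)
    (B : μ.SectionEdges) (S : μ.SupplyEdges) (P : μ.PublishedLeaves) (Q : μ.PreprintLeaves2026)
    (U : μ.UnwrittenLeaves) : Mok.T252 Γ :=
  h.t252.mp (μ.T252_of_leaves B S P Q U)

/-- **[Mok, Thm 5.1.2] AS PRINTED from the leaves** (projection of M10 `Mok2015.Nodes.main_of_leaves`:
`GlobalAll N = T242 ∧ T2410 ∧ T252 ∧ T254 ∧ T512 ∧ T521`), under the full reading.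
[cite: Mok2012, Thm 5.1.2 (bookkeeping proved here)] -/
theorem Mok.T512_of_leaves {μ : Mok2015.Nodes} {Γ : GlobalWorld} (h : Mok.ReadsFullGlobal μ Γ)
    (B : μ.SectionEdges) (S : μ.SupplyEdges) (P : μ.PublishedLeaves) (Q : μ.PreprintLeaves2026)
    (U : μ.UnwrittenLeaves) : Mok.T512 Γ :=
  h.t512.mp fun N => (μ.main_of_leaves B S P Q U N).2.2.2.2.2.1

/-- **[KMSW, Thm 5.0.1] on its PROVED region from the leaves** of the KMSW DAG in its proved scope (M11
`KMSW2014.Nodes.T171p_of_leaves`: chapter edges, supply edges, the Mok import, published leaves, the general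
weighted fundamental lemma), under the full reading.
[cite: KalethaEtAl2014, Thm 5.0.1 for generic ψ and pure inner twists (chap6 l.15; bookkeeping proved here)] -/
theorem KMSW.T501p_of_leaves {κ : KMSW2014.Nodes} {Γ : GlobalWorld} (h : KMSW.ReadsFullGlobal κ Γ)
    (B : κ.ChapterEdges) (S : κ.SupplyEdges) (I : κ.ImportedLeaves) (P : κ.PublishedLeaves)
    (U : κ.UnwrittenLeaves) : MultiplicityFormula Γ KMSW.globalProvedAt :=
  h.t171p.mp (κ.T171p_of_leaves B S I P U)

/-- **[KMSW, Thm* 1.7.1] AS STATED from the leaves** — needs in addition the two unwritten sequels (M11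
`KMSW2014.Nodes.full_of_leaves`, edge `E_Full`; `Full N = T161 ∧ LIR ∧ T171`), under the full reading.
[cite: KalethaEtAl2014, Thm* 1.7.1 as stated (l.348-351; bookkeeping proved here)] -/
theorem KMSW.T171_of_leaves {κ : KMSW2014.Nodes} {Γ : GlobalWorld} (h : KMSW.ReadsFullGlobal κ Γ)
    (B : κ.ChapterEdges) (S : κ.SupplyEdges) (I : κ.ImportedLeaves) (P : κ.PublishedLeaves)
    (U : κ.UnwrittenLeaves) (Q : κ.UnwrittenSequels) : KMSW.T171 Γ :=
  h.t171.mp fun N => (κ.full_of_leaves B S I P U Q N).2.2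

/-- A node assignment reading T152 / T412 in full (all other nodes arbitrary). [folklore] (consistency witness) -/
def Book.fullNodesGlobal (Γ : GlobalWorld) (rest : Nodes) : Nodes :=
  { rest with T152 := fun _ => Book.T152 Γ, T412 := fun _ => Book.T412 Γ }

/-- The full reading of T152 / T412 is CONSISTENT. [folklore] (consistency) -/
theorem Book.fullNodesGlobal_reads (Γ : GlobalWorld) (rest : Nodes) :
    Book.ReadsFullGlobal (Book.fullNodesGlobal Γ rest) Γ where
  t152 := ⟨fun H => H 0, fun H _ => H⟩
  t412 := ⟨fun H => H 0, fun H _ => H⟩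

/-- A node assignment reading [Mok] T252 / T512 in full. [folklore] (consistency witness) -/
def Mok.fullNodesGlobal (Γ : GlobalWorld) (rest : Mok2015.Nodes) : Mok2015.Nodes :=
  { rest with T252 := fun _ => Mok.T252 Γ, T512 := fun _ => Mok.T512 Γ }

/-- The full reading of T252 / T512 is CONSISTENT. [folklore] (consistency) -/
theorem Mok.fullNodesGlobal_reads (Γ : GlobalWorld) (rest : Mok2015.Nodes) :
    Mok.ReadsFullGlobal (Mok.fullNodesGlobal Γ rest) Γ where
  t252 := ⟨fun H => H 0, fun H _ => H⟩
  t512 := ⟨fun H => H 0, fun H _ => H⟩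

/-- A node assignment reading [KMSW] T171 / T171p in full. [folklore] (consistency witness) -/
def KMSW.fullNodesGlobal (Γ : GlobalWorld) (rest : KMSW2014.Nodes) : KMSW2014.Nodes :=
  { rest with T171 := fun _ => KMSW.T171 Γ, T171p := fun _ => MultiplicityFormula Γ KMSW.globalProvedAt }

/-- The full readings of T171 / T171p are CONSISTENT. [folklore] (consistency) -/
theorem KMSW.fullNodesGlobal_reads (Γ : GlobalWorld) (rest : KMSW2014.Nodes) :
    KMSW.ReadsFullGlobal (KMSW.fullNodesGlobal Γ rest) Γ where
  t171 := ⟨fun H => H 0, fun H _ => H⟩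
  t171p := ⟨fun H => H 0, fun H _ => H⟩

/-- **The proved-region reading does not give the stated region ([KMSW]).**  It is NOT the case that Thm 5.0.1
on `KMSW.globalProvedAt` implies it on `KMSW.globalStatedAt` for every global world: transport of M20's
`KMSW.global_separates` (its model `KMSW.sepGlobalWorld` fails exactly at the two cells deferred to the unwritten
[KMS_A], [KMS_B], `chap1mainthms.tex:L355`).  Hence what `KMSW.T501p_of_leaves` certifies is the proved scope,
never Thm* 1.7.1 as stated. [folklore] (assembled from `KMSW.global_separates`) -/
theorem KMSW.proved_reading_not_stated :
    ¬ ∀ Γ : GlobalWorld, MultiplicityFormula Γ KMSW.globalProvedAt → MultiplicityFormula Γ KMSW.globalStatedAt :=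
  fun h => KMSW.global_separates.2.2.2 (h _ KMSW.global_separates.1)

end GlobalFullReads

end Literature.NumberTheory.Automorphic.Arthur2013.Leaves
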